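import Summits.AtomisticToContinuum.HydrodynamicLimit.Theses.LambertianContactSwap
import Summits.AtomisticToContinuum.HydrodynamicLimit.Theses.LindebergRandomFuture
import HarnessLib

/-!
# `SwapGap` (stmt-AtomisticToContinuum-11850) from the EXISTING items of route `LindebergRandomFuture`

Helper file (`--supports stmt-AtomisticToContinuum-11850`) of line `Sketch` for the crux
`Summit.AtomisticToContinuum.HydrodynamicLimit.Theses.LambertianContactSwap.SwapGap` (lead c4, cycle 5, skeleton v8 §8).
The crux is wanted by two routes.  Route `LindebergRandomFuture` declares the byte-identical copy
`…Theses.LindebergRandomFuture.SwapGap` and files its transfer item `RandomFutureTransfer` (stmt-AtomisticToContinuum-11853)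
literally as `SlabMomentumClosure → SlabEnergyClosure → SwapGap` (stmt-11851, stmt-11852).  Hence the three EXISTING statement
items 11851 ∧ 11852 ∧ 11853 close this route's crux by modus ponens and definitional unfolding — recorded here so that the ledger
carries the cross-route reduction (a conditional result: the item itself stays open until its own signature is proved).
-/

namespace Summit.AtomisticToContinuum.HydrodynamicLimit.Theorems

open Summit.AtomisticToContinuum.HydrodynamicLimit.Theses

/-- **`LambertianContactSwap.SwapGap` ⇐ stmt-11851 ∧ stmt-11852 ∧ stmt-11853** (items of route `LindebergRandomFuture`):
`RandomFutureTransfer` is `SlabMomentumClosure → SlabEnergyClosure → LindebergRandomFuture.SwapGap`, and the two `SwapGap`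
declarations have the same body. [folklore] -/
theorem swapGap_of_randomFutureTransfer
    (h₁ : LindebergRandomFuture.SlabMomentumClosure) (h₂ : LindebergRandomFuture.SlabEnergyClosure)
    (h₃ : LindebergRandomFuture.RandomFutureTransfer) : LambertianContactSwap.SwapGap :=
  h₃ h₁ h₂

/-- The two copies of the shared crux are the same statement. [folklore] -/
theorem lambertianContactSwap_swapGap_iff_lindebergRandomFuture_swapGap :
    LambertianContactSwap.SwapGap ↔ LindebergRandomFuture.SwapGap :=
  Iff.rfl

end Summit.AtomisticToContinuum.HydrodynamicLimit.Theorems
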